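import Summits.CriticalPhenomena.PercolationContinuityZ3.Theorems.Transplant.SkelPhiNegReachHabRes2
import Summits.CriticalPhenomena.PercolationContinuityZ3.Theorems.Transplant.KNParaChainCorridorSN
import Summits.CriticalPhenomena.PercolationContinuityZ3.Theorems.Transplant.SkelPhiParaFrameChangeFine
import HarnessLib

/-!
# N1 (the `{±1}` node), (C) column file (C-A3): THE CORRIDOR RESIDUE OF THE N1 SCHEME OF RECORD FROM THE TWO-FRAME CORRIDOR OF RECORD —
# `reachOblAtHN_of_schedules₂SG₂` (C-A1) at segment 1 := the `(e − z)`-enlarged v-ROUNDS `P₁.scheduleNz 1 (cen y) hP₁ z` over the fine cell map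
# `F = fineSkel φ t₀ A n h vα vβ c₀' c₁' s₀ s₁ D` and segment 2 := the run-frame segment `corrRunSchedS P₂ … B aB σB …` (u-rounds ⧺ signed band) over
# `R = runX φ c₀ n h 1` at a frame-change vertex `c₀` with `F c₀ = cen y`: the planar rooms of segment 1 are DISCHARGED (`phase1z_*`, C-N5b), the cross
# link is DISCHARGED (`winIn_fine_subset_winIn_runX`, frame change), and the run-frame rooms enter in POINTWISE footprint form (`R v ∈ region/last core ⇒
# F v ∈ …`, discharged from numerics with `SkelPhiNegReachRoomsRun` (C-A2)); chain data, true targets, counts, kits, rim excess verbatim.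

builds on p205010 (kernel theorem, internal audit signed; external expert review pending) — nothing in this file uses p205010; nothing here is a
claim about the open node `SamePDropOfSkeletonNeg`.
Lane `prim-bschramm`, seat `prim-bschramm-p5` (gen 8; (C) lineage; C-FUNNEL.md §2); helper file (`--supports stmt-CriticalPhenomena-4575`).

* **`Skelφ.reachOblAtHN_negCorridor`**.
[cite: KozmaNitzan2024, §4 Lemma 12 (pp. 23–25), p. 26 (M_x, H_{v,x}), p. 30 (Step IV), p. 31] [cite: MartineauTassion2017, §4.3 Lemma 4.2]
-/

noncomputable section

open MeasureTheory ProbabilityTheory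
open scoped ENNReal Classical

namespace Summit.CriticalPhenomena.PercolationContinuityZ3.Theorems

namespace Transplant

namespace Skelφ

open Literature.Probability.Percolation Literature.Probability.LatticeModels SimpleGraph GadgetSystem ProbeHistory HSiteScheme Contour KNCells
open KNCells.KSchA KNLevels ChainPlanar ChainPara
open BoxProdZ2 (ConcRadiiG)
open TwoAxis.Para (modulus)
open Skel (ReachOblAtHN)

variable {V : Type} [DecidableEq V] {G : SimpleGraph V} [G.LocallyFinite] {φ : V → Site 2}

/-- **THE CORRIDOR RESIDUE OF THE N1 SCHEME OF RECORD FROM THE TWO-FRAME CORRIDOR OF RECORD** (v-rounds over the fine map ⟶ frame change at `c₀`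
⟶ u-rounds ⧺ signed band in the run frame).  Discharged here: `hM0`, `hreg₁` (phase-1 planar rooms `3r ≤ (L0, W)`, `max L0 sHi + e + La ≤ 5r₁`,
`W + N·e + e + Lb ≤ 5r₀`), the cross link (frame-change inequalities `ha hBx hb` at the last rounds' box `cen ± (K₀, K₁)`); hypotheses kept: the
run-frame footprint rooms (pointwise), the depth room, chain data / true targets / counts / kits / rim excess.
[cite: KozmaNitzan2024, §4 Lemma 12 (pp. 23–25), p. 30 (Step IV), p. 31] [cite: MartineauTassion2017, §4.3 Lemma 4.2] -/
theorem reachOblAtHN_negCorridor {t₀ : V} {A : ℤ} (hA : 0 < A) {n : ℕ} (hn : 1 ≤ n) {h vα vβ : ℤ} (hm : 0 < modulus n h vα vβ)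
    {c₀' c₁' s₀ s₁ D : ℤ} (hc₀' : 0 < c₀') (hc₁' : 0 < c₁') (hD : 0 < D)
    (F : V → Site 2) (hFdef : F = fineSkel φ t₀ A n h vα vβ c₀' c₁' s₀ s₁ D) (hlipF : Lip G F)
    (c₀ : V) (R : V → Site 2) (hRdef : R = runX φ c₀ n h 1) (hlipR : Lip G R)
    {P : PCells2} {Λ : ConcRadiiG} {q : unitInterval} {δc : ℝ}
    (S : KSchA V ℕ) (hS : S = ⟨cellGeomSG₂ G F P t₀ Λ, q, δc⟩) (FD : FaceData V ℕ) (hFD : FD = faceDataSG G F P t₀ Λ) {LD : LevelData V ℕ}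
    (hL : LevelGeom G S.Γ FD LD) (hQ : QSepGeom G S.Γ) (hSt : StepsGeom S.Γ FD) (hEx : ExitGeom G S.Γ)
    {hist : ProbeHistory V} {e : Site 2 × MDir} (hV : S.Valid₂ G hist e) {a' : ℕ} (ha' : a' ∈ S.Γ.anchSet (S.aOf₁ G hist e) (tgt e))
    {du : MDir} (hdu : du ∈ S.onward G hist (tgt e)) (hdur : du ≠ rev e.2) {nmax : ℕ}
    (Ω : Finset V) (hΩ : Ω = S.Γ.Ewv (S.aOf₁ G hist e) e.1 e.2 ∪ FD.Hfull a' (tgt e) du)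
    (hc₀ : F c₀ = P.cen (tgt e))
    -- segment 1: the `(e − z)`-enlarged v-rounds about `cen y` and their planar rooms
    (P₁ : LocPrm) (hP₁ : LocOK P₁) (z : ℕ)
    (h3r₁ : 3 * (P.r 1 : ℤ) ≤ P₁.L0) (h3r₀ : 3 * (P.r 0 : ℤ) ≤ P₁.W)
    (h5r₁ : max (P₁.L0 : ℤ) P₁.sHi + P₁.e + P₁.La ≤ 5 * (P.r 1 : ℤ)) (h5r₀ : P₁.Wk P₁.N + P₁.e + P₁.Lb ≤ 5 * (P.r 0 : ℤ))
    -- segment 2: the run-frame segment (u-rounds `P₂`, signed band `B` along `aB`)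
    (P₂ : LocPrm) (hP₂ : LocOK P₂) (B : RunPrm) (aB : Fin 2) {σB : ℤ} (hσB : σB = 1 ∨ σB = -1) (hB : RunOK B) (heb : B.eb = B.ea)
    (hR' : B.ea = P₂.e) (hjoin : (P₂.scheduleN 0 0 hP₂).core (P₂.N + 1) ⊆ (B.scheduleN aB hσB 0 hB heb).core 0)
    (hreg : (B.scheduleN aB hσB 0 hB heb).core 0 ⊆ (P₂.scheduleN 0 0 hP₂).region P₂.N)
    -- the cross link: the last rounds' box `cen ± (K₀, K₁)` read into the run frame's start box `{|α| ≤ L0₂, |⌊β′/U⌋| ≤ W₂}`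
    {K₀ K₁ : ℕ} (hcoreK : (P₁.scheduleNz 1 (P.cen (tgt e)) hP₁ z).core (P₁.N + 1) ⊆
      Finset.Icc (P.cen (tgt e) - ![(K₀ : ℤ), K₁]) (P.cen (tgt e) + ![(K₀ : ℤ), K₁]))
    {Bx : ℤ} (ha : D * (c₁' * (n : ℤ) * (K₀ + 1) + c₀' * |vα| * (K₁ + 1)) ≤ c₀' * c₁' * A * modulus n h vα vβ * P₂.L0)
    (hBx : D * ((K₁ : ℤ) + 1) ≤ c₁' * A * Bx) (hb : Bx / (shearUnit n h : ℤ) + 1 ≤ P₂.W)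
    -- the run-frame footprint rooms, pointwise
    (hroom₂ : ∀ k ≤ P₂.N, ∀ v : V, R v ∈ P₂.pregion 0 0 k → F v ∈ P.Q (tgt e) ∪ P.Hfull (tgt e) du)
    (hroomB : ∀ j ≤ B.N, ∀ v : V, R v ∈ B.pregion aB σB 0 j → F v ∈ P.Q (tgt e) ∪ P.Hfull (tgt e) du)
    (hroomL : ∀ v : V, R v ∈ B.pcore aB σB 0 (B.N + 1) → F v ∈ P.Hfull (tgt e) du ∧ Finset.Icc (F v - 1) (F v + 1) ⊆ P.M (tgt e + stepVec du))
    -- depth room of the last cube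
    (hρM : ∀ ℓ, Λ.ρ a' (tgt e) du ℓ + 1 ≤ Λ.rM a' (tgt e + stepVec du))
    (hlen : P₁.N + 1 + (P₂.N + 1 + B.N) ≤ nmax)
    -- chain data over the two frames
    (S₁f S₂f : SchedFrame) (hS₁f : S₁f = (P₁.scheduleNz 1 (P.cen (tgt e)) hP₁ z).toFrame)
    (hS₂f : S₂f = (corrRunSchedS P₂ hP₂ B aB hσB hB heb hR' hjoin hreg).toFrame)
    (C₁ C₂ : WinChainData V) (hPo₁ : C₁.o = S.Γ.root) (hPo₂ : C₂.o = S.Γ.root)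
    (hPS₁ : C₁.Sfin = S.Sx G hist e (S.aOf₁ G hist e) a' du) (hPS₂ : C₂.Sfin = S.Sx G hist e (S.aOf₁ G hist e) a' du)
    (hRim₁ : ∀ k, C₁.Rim k ⊆ (planarWindowIn hlipF Ω).stepDF S₁f k) (hRim₂ : ∀ k, C₂.Rim k ⊆ (planarWindowIn hlipR Ω).stepDF S₂f k)
    (hRl₁ : C₁.Rlev + 1 ≤ S₁f.R') (hRl₂ : C₂.Rlev + 1 ≤ S₂f.R') (hj₁ : C₁.j₁ ≤ C₁.Rlev) (hj₂ : C₂.j₁ ≤ C₂.Rlev)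
    (hTne₁ : ∀ k ≤ S₁f.N, ((planarWindowIn hlipF Ω).coreTF S₁f k).Nonempty) (hTne₂ : ∀ k ≤ S₂f.N, ((planarWindowIn hlipR Ω).coreTF S₂f k).Nonempty)
    -- analytic inputs
    {Δ' : ℕ} {δ η : ℝ}
    (hcount₁ : 1 / (1 - (S.p : ℝ)) ^ (Δ' * C₁.N) ≤ δ * ((Finset.Icc C₁.j₀ C₁.j₁).card : ℝ))
    (hcount₂ : 1 / (1 - (S.p : ℝ)) ^ (Δ' * C₂.N) ≤ δ * ((Finset.Icc C₂.j₀ C₂.j₁).card : ℝ))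
    (hkits₁ : ∀ k ≤ S₁f.N, ∀ j ∈ Finset.Icc C₁.j₀ C₁.j₁, ∃ (σ : SData V) (Sz : Finset V),
      SHyp (C₁.stepLF (planarWindowIn hlipF Ω) S₁f k) j σ ∧ σ.N ≤ C₁.N ∧
      (1 - (S.p : ℝ) ^ σ.sB) ^ σ.k ≤ δ ∧ Sz ⊆ (C₁.stepLF (planarWindowIn hlipF Ω) S₁f k).X j ∧ Sz ⊆ (planarWindowIn hlipF Ω).stepDF S₁f k ∧
      (∀ x ∈ σ.K, ∀ e' ∈ σ.seed x, e' ∉ wireSet (↑Sz : Set V)) ∧ (∀ x ∈ σ.K, σ.face x ⊆ Sz) ∧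
      (∀ x ∈ σ.K, 1 - 3 * δ ≤ (prodBernoulli (S.Wcor G FD hist e (S.aOf₁ G hist e) a' du)).real {ω | ∃ u ∈ σ.face x,
        1 - δ < (prodBernoulli (pinW (S.Wcor G FD hist e (S.aOf₁ G hist e) a' du) (wireSet (↑Sz : Set V)) ω)).real
          (⋃ t' ∈ C₁.coreEF (planarWindowIn hlipF Ω) S₁f k, openConnIn (↑((planarWindowIn hlipF Ω).stepDF S₁f k) : Set V) u t')}))
    (hkits₂ : ∀ k ≤ S₂f.N, ∀ j ∈ Finset.Icc C₂.j₀ C₂.j₁, ∃ (σ : SData V) (Sz : Finset V),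
      SHyp (C₂.stepLF (planarWindowIn hlipR Ω) S₂f k) j σ ∧ σ.N ≤ C₂.N ∧
      (1 - (S.p : ℝ) ^ σ.sB) ^ σ.k ≤ δ ∧ Sz ⊆ (C₂.stepLF (planarWindowIn hlipR Ω) S₂f k).X j ∧ Sz ⊆ (planarWindowIn hlipR Ω).stepDF S₂f k ∧
      (∀ x ∈ σ.K, ∀ e' ∈ σ.seed x, e' ∉ wireSet (↑Sz : Set V)) ∧ (∀ x ∈ σ.K, σ.face x ⊆ Sz) ∧
      (∀ x ∈ σ.K, 1 - 3 * δ ≤ (prodBernoulli (S.Wcor G FD hist e (S.aOf₁ G hist e) a' du)).real {ω | ∃ u ∈ σ.face x,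
        1 - δ < (prodBernoulli (pinW (S.Wcor G FD hist e (S.aOf₁ G hist e) a' du) (wireSet (↑Sz : Set V)) ω)).real
          (⋃ t' ∈ C₂.coreEF (planarWindowIn hlipR Ω) S₂f k, openConnIn (↑((planarWindowIn hlipR Ω).stepDF S₂f k) : Set V) u t')}))
    (hη : η ≤ δ / 2)
    (hexc₁ : ∀ k ≤ S₁f.N, (prodBernoulli (S.Wcor G FD hist e (S.aOf₁ G hist e) a' du)).real (⋃ t' ∈ C₁.Rim k, openConn S.Γ.root t') ≤ η)
    (hexc₂ : ∀ k ≤ S₂f.N, (prodBernoulli (S.Wcor G FD hist e (S.aOf₁ G hist e) a' du)).real (⋃ t' ∈ C₂.Rim k, openConn S.Γ.root t') ≤ η) :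
    ReachOblAtHN G nmax S FD Δ' δ hist e a' du := by
  set y := tgt e with hydef
  -- frame identities
  have hN₁ : S₁f.N = P₁.N := by rw [hS₁f]; rfl
  have hN₂ : S₂f.N = P₂.N + 1 + B.N := by rw [hS₂f]; rfl
  have hcore₁ : ∀ k, S₁f.core k = (P₁.scheduleNz 1 (P.cen y) hP₁ z).core k := fun k => by rw [hS₁f]; rfl
  have hregion₁ : ∀ k, S₁f.region k = (P₁.scheduleNz 1 (P.cen y) hP₁ z).region k := fun k => by rw [hS₁f]; rfl
  have hcore₂ : ∀ k, S₂f.core k = (corrRunSchedS P₂ hP₂ B aB hσB hB heb hR' hjoin hreg).core k := fun k => by rw [hS₂f]; rfl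
  have hregion₂ : ∀ k, S₂f.region k = (corrRunSchedS P₂ hP₂ B aB hσB hB heb hR' hjoin hreg).region k := fun k => by rw [hS₂f]; rfl
  refine reachOblAtHN_of_schedules₂SG₂ hlipF hlipR S hS FD hFD hL hQ hSt hEx hV ha' hdu hdur Ω hΩ S₁f S₂f ?_ ?_ ?_ ?_ ?_ hρM
    (by rw [hN₁, hN₂]; exact hlen) C₁ C₂ hPo₁ hPo₂ hPS₁ hPS₂ hRim₁ hRim₂ hRl₁ hRl₂ hj₁ hj₂ hTne₁ hTne₂ hcount₁ hcount₂ hkits₁ hkits₂ hη hexc₁ hexc₂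
  · -- `P.M y ⊆ core 0`
    rw [hcore₁]; exact phase1z_core_zero_supset_M P y P₁ hP₁ z h3r₁ h3r₀
  · -- rounds' regions inside `Q y`
    intro k hk; rw [hregion₁]; rw [hN₁] at hk
    exact (phase1z_region_subset_Q P y P₁ hP₁ z h5r₁ h5r₀ hk).trans Finset.subset_union_left
  · -- the cross link at `c₀`
    rw [hcore₁, hN₁, hcore₂, corrRunSchedS_core_zero]
    refine (WinIn_mono F subset_rfl hcoreK).trans ?_
    rw [← hc₀, hFdef, hRdef]
    refine (winIn_fine_subset_winIn_runX (s₀ := s₀) (s₁ := s₁) hA hn hm hc₀' hc₁' hD t₀ c₀ (Or.inl rfl) Ω ha hBx hb).trans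
      (WinIn_mono _ subset_rfl ?_)
    intro g hg
    rw [Finset.mem_Icc, Pi.le_def, Pi.le_def, Fin.forall_fin_two, Fin.forall_fin_two] at hg
    simp only [Pi.neg_apply, Matrix.cons_val_zero, Matrix.cons_val_one] at hg
    have h10 : Literature.Probability.Percolation.KozmaNitzan.Cells.oth (0 : Fin 2) = 1 := by decide
    rw [← LocPrm.scheduleN_core P₂ 0 0 hP₂, LocPrm.mem_scheduleN_core_zero, h10]
    simp only [Pi.zero_apply, sub_zero]
    exact ⟨abs_le.2 ⟨hg.1.1, hg.2.1⟩, abs_le.2 ⟨hg.1.2, hg.2.2⟩⟩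
  · -- run-frame regions: rounds' or band's
    intro k hk v _ hvR
    rw [hN₂] at hk; rw [hregion₂] at hvR
    rcases corrRunSchedS_region_cases P₂ hP₂ B aB hσB hB heb hR' hjoin hreg hk with ⟨hk', hrg⟩ | ⟨j, hj, -, hrg⟩
    · rw [hrg] at hvR; exact hroom₂ k hk' v hvR
    · rw [hrg] at hvR; exact hroomB j hj v hvR
  · -- the last core
    intro v _ hvR
    have hN₂' : S₂f.N = (corrRunSchedS P₂ hP₂ B aB hσB hB heb hR' hjoin hreg).N := by rw [hS₂f]; rfl
    rw [hcore₂, hN₂', corrRunSchedS_core_last] at hvR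
    exact hroomL v hvR

end Skelφ

end Transplant

end Summit.CriticalPhenomena.PercolationContinuityZ3.Theorems

end
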